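import Summits.QuantumFields.YangMills.Theorems.UnitScaleTiltCurvGradFlatKernel
import HarnessLib

/-!
# Flat-lattice input of the curvature-gradient bound, file 2/3: Abel summation of one data term against `∇g·χ`, and the cut-off term
# (`kernel₁`) of the Green representation of `χ·u` — the two halves of the interior log-Lipschitz estimate (file 3/3 `…CurvGradFlatPoisson`)

Helper file (`--supports stmt-QuantumFields-19200`, crux child «MinimiserStabilityRegPr» of rung R3's K1, cell `ym3-torus`, seat
`ym3-torus-p1` gen 13; memo HOME/UV3-NODE.md §22).  Theorems only; no new definition.

* §0 bookkeeping (unit steps, sup norm, far sites);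
* §1 **`abel_sum_le`** — for `‖x‖ ≤ 1`, a unit step `v`, a weight `ψ` (`|ψ| ≤ 1`, `(1/R)`-Lipschitz along `v`, constant along `v` deep
  inside) and data `h` (`|h| ≤ B`): `|Σ_y (g(x+e_j−y) − g(x−y))·ψ(y)·(h(y+v) − h(y))| ≤ B·A_R`, `A_R = O(1 + log R)` — the difference is
  moved from `h` onto `∇g·ψ` (second differences of `g = G/2`, file 1/3 `exists_gHalf_hess_le`, against the logarithmic shell sum
  `sum_sbox_inv_pow_le`; the `∇g·∇ψ` piece lives on the annulus and is bounded);
* §2 `sum_gHalf_mul_cutoffTerm_eq` (the cut-off term is the tree's harmonic-case kernel `kernel₁`, for ANY `u`) and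
  **`kernel_diff_sum_le`** (its `x`-difference is `O(M₀/R)` in `ℓ¹`: kink counting `sum_abs_dtwo_le` + annulus).

References: G. F. Lawler, V. Limic, *Random Walk: A Modern Introduction* (2010) Thm. 4.3.1 / 6.3.8 (kernel bounds, the harmonic case —
tree `WeakCouplingRatesHarmonicInterior*`).  No sorry, standard axioms.  NOT a claim about the mass gap.
-/


set_option autoImplicit false

noncomputable section

open Finset
open Literature.Probability.LatticeModels
open Literature.MathematicalPhysics.QuantumFieldTheory.LatticeForm (e)
open Summit.QuantumFields.YangMills.Theorems.WeakCouplingRates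
  (abs_coord_le_norm norm_le_sqrt_sum_sq one_le_norm_of_ne_zero norm_e)
open Summit.QuantumFields.YangMills.Theorems.WeakCouplingRates.HarmonicInterior

namespace Summit.QuantumFields.YangMills.Theorems.CurvGradFlat

variable {d : ℕ}

/-! ## §0 Bookkeeping on unit steps and norms -/

/-- A unit step `v = ±eᵢ` has all coordinates of absolute value `≤ 1`. [folklore] -/
theorem abs_apply_le_one_of_unit {i : Fin d} {v : Site d} (hv : v = e i ∨ v = -e i) (k : Fin d) : |v k| ≤ 1 := by
  rcases hv with h | h <;> subst h
  · by_cases hk : k = i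
    · subst hk; simp
    · simp [hk]
  · by_cases hk : k = i
    · subst hk; simp [show (e k : Site d) = Pi.single k (1 : ℤ) from rfl]
    · simp [show (e i : Site d) = Pi.single i (1 : ℤ) from rfl, hk]

/-- The sup norm is attained-bounded by coordinates: `‖x‖ ≤ c` if all `|x_k| ≤ c`. [folklore] -/
theorem norm_le_of_forall_abs_le {x : Site d} {c : ℝ} (hc : 0 ≤ c) (h : ∀ k, |((x k : ℤ) : ℝ)| ≤ c) : ‖x‖ ≤ c :=
  (pi_norm_le_iff_of_nonneg hc).2 fun k => by rw [Int.norm_eq_abs]; exact h k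

/-- If some coordinate satisfies `ρ ≤ |y_i|` then `ρ ≤ ‖y‖`. [folklore] -/
theorem le_norm_of_le_abs_apply {y : Site d} {i : Fin d} {ρ : ℝ} (h : ρ ≤ |((y i : ℤ) : ℝ)|) : ρ ≤ ‖y‖ :=
  h.trans (abs_coord_le_norm y i)

/-- Far sites: if `ρ ≤ |z_i|` and `‖x‖ ≤ c` then `ρ − c ≤ max 1 ‖x − z‖`. [folklore] -/
theorem sub_le_max_norm_sub {x z : Site d} {c : ℝ} (hx : ‖x‖ ≤ c) {i : Fin d} {ρ : ℝ} (hz : ρ ≤ |((z i : ℤ) : ℝ)|) :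
    ρ - c ≤ max 1 ‖x - z‖ := by
  have h1 : ρ ≤ ‖z‖ := le_norm_of_le_abs_apply hz
  have h2 : ‖z‖ ≤ ‖x‖ + ‖x - z‖ := by
    have := norm_sub_le x (x - z); rwa [sub_sub_cancel] at this
  linarith [le_max_right (1 : ℝ) ‖x - z‖]

/-- Power comparison used for far sites: `K/(max 1 ‖w‖)^n ≤ K·(c/R)^n` once `R/c ≤ max 1 ‖w‖` (`K ≥ 0`, `R, c > 0`). [folklore] -/
theorem div_max_pow_le {K : ℝ} (hK : 0 ≤ K) {R c : ℝ} (hR : 0 < R) (hc : 0 < c) {w : Site d} (n : ℕ)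
    (hw : R / c ≤ max 1 ‖w‖) : K / (max 1 ‖w‖) ^ n ≤ K * (c / R) ^ n := by
  have hm : 0 < max 1 ‖w‖ := lt_of_lt_of_le zero_lt_one (le_max_left _ _)
  rw [div_eq_mul_inv, ← inv_pow]
  refine mul_le_mul_of_nonneg_left (pow_le_pow_left₀ (inv_nonneg.2 hm.le) ?_ n) hK
  rw [inv_le_comm₀ hm (by positivity), inv_div]
  exact hw

/-! ## §1 The Abel-summed data term -/

/-- **ABEL SUMMATION OF ONE DATA TERM.**  For `‖x‖ ≤ 1`, a unit step `v = ±eᵢ`, a weight `ψ` with `|ψ| ≤ 1`, `(1/R)`-Lipschitz along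
`v` and constant along `v` deep inside (`|y_i| + 2 ≤ R`), and data `h` with `|h| ≤ B` on `sbox (2R+1)` and `ψ(· − v)·h = 0` off
`sbox (2R)`:
`|Σ_{y ∈ sbox(2R+1)} (g(x+e_j−y) − g(x−y))·ψ(y)·(h(y+v) − h(y))| ≤ B·A_R`,
`A_R = K_h 3^d·[3^d(1+2d3^{d−1})(2+log(2R+1))] + K_g 2^{d−1} 5^d` — the difference is moved from `h` onto `∇g·ψ`: second
differences of `g` (logarithmic shell sum) plus `∇g · ∇ψ` on the annulus (bounded). [folklore] -/
theorem abel_sum_le (hd : 3 ≤ d) {Kg Kh : ℝ} (hKg : 0 ≤ Kg) (hKh : 0 ≤ Kh)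
    (hg : ∀ (w : Site d) (i : Fin d), |gHalf (w + e i) - gHalf w| ≤ Kg / (max 1 ‖w‖) ^ (d - 1) ∧
      |gHalf (w - e i) - gHalf w| ≤ Kg / (max 1 ‖w‖) ^ (d - 1))
    (hh : ∀ (w : Site d) (i j : Fin d), |gHalf (w + e j + e i) - gHalf (w + e j) - gHalf (w + e i) + gHalf w| ≤ Kh / (max 1 ‖w‖) ^ d)
    {R : ℕ} (hR : 4 ≤ R) (x : Site d) (hx : ‖x‖ ≤ 1) (j i : Fin d) (v : Site d) (hv : v = e i ∨ v = -e i)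
    (ψ : Site d → ℝ) (hψ1 : ∀ y, |ψ y| ≤ 1) (hψR : ∀ y, |ψ (y - v) - ψ y| ≤ 1 / R)
    (hψ0 : ∀ y : Site d, |y i| + 2 ≤ (R : ℤ) → ψ (y - v) = ψ y)
    (h : Site d → ℝ) {B : ℝ} (hB : ∀ y ∈ sbox (d := d) (2 * R + 1), |h y| ≤ B)
    (hF : ∀ y ∉ sbox (d := d) (2 * R), ψ (y - v) * h y = 0) :
    |∑ y ∈ sbox (d := d) (2 * R + 1), (gHalf (x + e j - y) - gHalf (x - y)) * (ψ y * (h (y + v) - h y))| ≤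
      B * (Kh * 3 ^ d * (3 ^ d * ((1 + 2 * d * 3 ^ (d - 1)) * (2 + Real.log (2 * R + 1 : ℕ)))) + Kg * 2 ^ (d - 1) * 5 ^ d) := by
  have hR0 : 0 < R := by omega
  have hRr : (0 : ℝ) < R := by exact_mod_cast hR0
  have hR4 : (4 : ℝ) ≤ R := by exact_mod_cast hR
  have hd1 : 1 ≤ d := by omega
  have hB0 : 0 ≤ B := (abs_nonneg _).trans (hB 0 (mem_sbox.2 fun k => by simp only [Pi.zero_apply, abs_zero]; positivity))
  -- the first difference of the kernel in direction `e_j`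
  set D : Site d → ℝ := fun w => gHalf (w + e j) - gHalf w with hD
  have hsummand : ∀ y, (gHalf (x + e j - y) - gHalf (x - y)) * (ψ y * (h (y + v) - h y)) =
      D (x - y) * ψ y * h (y + v) - D (x - y) * ψ y * h y := by
    intro y; simp only [hD, show x + e j - y = x - y + e j by abel]; ring
  rw [Finset.sum_congr rfl fun y _ => hsummand y, Finset.sum_sub_distrib]
  -- Abel shift of the first sum
  set F : Site d → ℝ := fun w => D (x - w + v) * ψ (w - v) * h w with hFdef
  have hF0 : ∀ z ∉ sbox (d := d) (2 * R), F z = 0 := by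
    intro z hz; simp only [hFdef]; rw [mul_assoc, hF z hz, mul_zero]
  have hshift := sum_sbox_shift (R := 2 * R) F hF0 v (abs_apply_le_one_of_unit hv)
  have hFv : ∀ y, F (y + v) = D (x - y) * ψ y * h (y + v) := by
    intro y; simp only [hFdef, show x - (y + v) + v = x - y by abel, add_sub_cancel_right]
  rw [show ∑ y ∈ sbox (d := d) (2 * R + 1), D (x - y) * ψ y * h (y + v) = ∑ y ∈ sbox (d := d) (2 * R + 1), F (y + v) from
    Finset.sum_congr rfl fun y _ => (hFv y).symm, hshift, ← Finset.sum_sub_distrib]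
  -- pointwise form `h(y)·[(D(x−y+v) − D(x−y))ψ(y−v) + D(x−y)(ψ(y−v) − ψ y)]`
  have hpt : ∀ y, F y - D (x - y) * ψ y * h y =
      h y * ((D (x - y + v) - D (x - y)) * ψ (y - v) + D (x - y) * (ψ (y - v) - ψ y)) := by
    intro y; simp only [hFdef]; ring
  rw [Finset.sum_congr rfl fun y _ => hpt y]
  refine (Finset.abs_sum_le_sum_abs _ _).trans ?_
  -- termwise bounds
  have hx2 : ‖x‖ ≤ 2 := hx.trans (by norm_num)
  have hxi2 : ‖x - e i‖ ≤ 2 := by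
    have := norm_sub_le x (e i); rw [norm_e] at this; linarith
  -- (a) the second-difference piece
  have hD2 : ∀ y, |D (x - y + v) - D (x - y)| ≤ Kh * 3 ^ d * ((max 1 ‖y‖) ^ d)⁻¹ := by
    intro y
    rcases hv with hv | hv
    · -- `v = e_i`: Hessian at `w = x − y`
      have h1 := hh (x - y) j i
      have e1 : D (x - y + v) - D (x - y) = gHalf (x - y + e i + e j) - gHalf (x - y + e i) - gHalf (x - y + e j) + gHalf (x - y) := by
        simp only [hD, hv]; ring
      rw [e1]
      calc |gHalf (x - y + e i + e j) - gHalf (x - y + e i) - gHalf (x - y + e j) + gHalf (x - y)| ≤ Kh / (max 1 ‖x - y‖) ^ d := h1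
        _ = Kh * ((max 1 ‖x - y‖) ^ d)⁻¹ := div_eq_mul_inv _ _
        _ ≤ Kh * (3 ^ d * ((max 1 ‖y‖) ^ d)⁻¹) := mul_le_mul_of_nonneg_left (inv_max_one_norm_sub_pow_le hx2 y) hKh
        _ = Kh * 3 ^ d * ((max 1 ‖y‖) ^ d)⁻¹ := by ring
    · -- `v = −e_i`: minus the Hessian at `w' = x − e_i − y`
      have h1 := hh (x - e i - y) j i
      have e1 : D (x - y + v) - D (x - y) =
          -(gHalf (x - e i - y + e i + e j) - gHalf (x - e i - y + e i) - gHalf (x - e i - y + e j) + gHalf (x - e i - y)) := by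
        simp only [hD, hv, show x - e i - y + e i = x - y by abel, show x - y + -e i = x - e i - y by abel]; ring
      rw [e1, abs_neg]
      calc |gHalf (x - e i - y + e i + e j) - gHalf (x - e i - y + e i) - gHalf (x - e i - y + e j) + gHalf (x - e i - y)|
          ≤ Kh / (max 1 ‖x - e i - y‖) ^ d := h1
        _ = Kh * ((max 1 ‖x - e i - y‖) ^ d)⁻¹ := div_eq_mul_inv _ _
        _ ≤ Kh * (3 ^ d * ((max 1 ‖y‖) ^ d)⁻¹) := mul_le_mul_of_nonneg_left (inv_max_one_norm_sub_pow_le hxi2 y) hKh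
        _ = Kh * 3 ^ d * ((max 1 ‖y‖) ^ d)⁻¹ := by ring
  -- (b) the gradient-times-`∇ψ` piece (annulus)
  have hD1 : ∀ y, |D (x - y) * (ψ (y - v) - ψ y)| ≤ Kg * 2 ^ (d - 1) / R ^ d := by
    intro y
    by_cases hdeep : |y i| + 2 ≤ (R : ℤ)
    · rw [hψ0 y hdeep, sub_self, mul_zero, abs_zero]; positivity
    · -- far site: `R − 1 ≤ |y_i|`, so `R/2 ≤ max 1 ‖x − y‖`
      have hyi : (R : ℝ) - 1 ≤ |((y i : ℤ) : ℝ)| := by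
        have : (R : ℤ) - 1 ≤ |y i| := by omega
        exact_mod_cast this
      have hfar : (R : ℝ) / 2 ≤ max 1 ‖x - y‖ := by
        have := sub_le_max_norm_sub hx hyi; linarith
      rw [abs_mul]
      have hg1 : |D (x - y)| ≤ Kg * (2 / R) ^ (d - 1) :=
        ((hg (x - y) j).1).trans (div_max_pow_le hKg hRr two_pos (d - 1) hfar)
      calc |D (x - y)| * |ψ (y - v) - ψ y| ≤ Kg * (2 / R) ^ (d - 1) * (1 / R) :=
            mul_le_mul hg1 (hψR y) (abs_nonneg _) (by positivity)
        _ = Kg * 2 ^ (d - 1) / R ^ d := by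
            have hRd : (R : ℝ) ^ d = (R : ℝ) ^ (d - 1) * R := by rw [← pow_succ, Nat.sub_add_cancel hd1]
            rw [div_pow, hRd]
            field_simp
  -- termwise
  have hterm : ∀ y ∈ sbox (d := d) (2 * R + 1),
      |h y * ((D (x - y + v) - D (x - y)) * ψ (y - v) + D (x - y) * (ψ (y - v) - ψ y))| ≤
        B * (Kh * 3 ^ d * ((max 1 ‖y‖) ^ d)⁻¹) + B * (Kg * 2 ^ (d - 1) / R ^ d) := by
    intro y hy
    rw [abs_mul]
    have h1 : |(D (x - y + v) - D (x - y)) * ψ (y - v) + D (x - y) * (ψ (y - v) - ψ y)| ≤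
        Kh * 3 ^ d * ((max 1 ‖y‖) ^ d)⁻¹ + Kg * 2 ^ (d - 1) / R ^ d := by
      refine (abs_add_le _ _).trans (add_le_add ?_ (hD1 y))
      rw [abs_mul]
      calc |D (x - y + v) - D (x - y)| * |ψ (y - v)| ≤ Kh * 3 ^ d * ((max 1 ‖y‖) ^ d)⁻¹ * 1 :=
            mul_le_mul (hD2 y) (hψ1 _) (abs_nonneg _) (by positivity)
        _ = Kh * 3 ^ d * ((max 1 ‖y‖) ^ d)⁻¹ := mul_one _
    calc |h y| * |(D (x - y + v) - D (x - y)) * ψ (y - v) + D (x - y) * (ψ (y - v) - ψ y)|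
        ≤ B * (Kh * 3 ^ d * ((max 1 ‖y‖) ^ d)⁻¹ + Kg * 2 ^ (d - 1) / R ^ d) := mul_le_mul (hB y hy) h1 (abs_nonneg _) hB0
      _ = B * (Kh * 3 ^ d * ((max 1 ‖y‖) ^ d)⁻¹) + B * (Kg * 2 ^ (d - 1) / R ^ d) := by ring
  refine (Finset.sum_le_sum hterm).trans ?_
  rw [Finset.sum_add_distrib, Finset.sum_const, card_sbox, nsmul_eq_mul, ← Finset.mul_sum, ← Finset.mul_sum]
  -- the logarithmic shell sum and the annulus count
  have hlog := sum_sbox_inv_pow_le (d := d) hd1 (N := 2 * R + 1) (by omega)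
  have hcard : ((2 * (2 * R + 1) + 1) ^ d : ℕ) * (B * (Kg * 2 ^ (d - 1) / R ^ d)) ≤ B * (Kg * 2 ^ (d - 1) * 5 ^ d) := by
    have h5 : ((2 * (2 * R + 1) + 1 : ℕ) : ℝ) ≤ 5 * R := by push_cast; linarith
    have hpow : (((2 * (2 * R + 1) + 1) ^ d : ℕ) : ℝ) ≤ (5 * R) ^ d := by
      push_cast
      exact pow_le_pow_left₀ (by positivity) (by push_cast at h5; linarith) d
    calc (((2 * (2 * R + 1) + 1) ^ d : ℕ) : ℝ) * (B * (Kg * 2 ^ (d - 1) / R ^ d))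
        ≤ (5 * R) ^ d * (B * (Kg * 2 ^ (d - 1) / R ^ d)) := mul_le_mul_of_nonneg_right hpow (by positivity)
      _ = B * (Kg * 2 ^ (d - 1) * 5 ^ d) := by
          rw [mul_pow]; field_simp
  have hA : B * (Kh * 3 ^ d * ∑ y ∈ sbox (d := d) (2 * R + 1), ((max 1 ‖y‖) ^ d)⁻¹) ≤
      B * (Kh * 3 ^ d * (3 ^ d * ((1 + 2 * d * 3 ^ (d - 1)) * (2 + Real.log (2 * R + 1 : ℕ))))) := by
    refine mul_le_mul_of_nonneg_left ?_ hB0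
    refine mul_le_mul_of_nonneg_left ?_ (by positivity)
    -- `Σ (max 1 ‖y‖)^{-d} ≤ (1+2d3^{d-1})(2+log N) ≤ 3^d · (…)`
    have h1 : (1 : ℝ) ≤ 3 ^ d := one_le_pow₀ (by norm_num)
    have hpos : 0 ≤ (1 + 2 * (d : ℝ) * 3 ^ (d - 1)) * (2 + Real.log (2 * R + 1 : ℕ)) := by
      have : 0 ≤ Real.log (2 * R + 1 : ℕ) := Real.log_nonneg (by exact_mod_cast (show 1 ≤ 2 * R + 1 by omega))
      positivity
    calc ∑ y ∈ sbox (d := d) (2 * R + 1), ((max 1 ‖y‖) ^ d)⁻¹ ≤ (1 + 2 * d * 3 ^ (d - 1)) * (2 + Real.log (2 * R + 1 : ℕ)) := hlog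
      _ = 1 * ((1 + 2 * d * 3 ^ (d - 1)) * (2 + Real.log (2 * R + 1 : ℕ))) := (one_mul _).symm
      _ ≤ 3 ^ d * ((1 + 2 * d * 3 ^ (d - 1)) * (2 + Real.log (2 * R + 1 : ℕ))) := mul_le_mul_of_nonneg_right h1 hpos
  calc B * (Kh * 3 ^ d * ∑ y ∈ sbox (d := d) (2 * R + 1), ((max 1 ‖y‖) ^ d)⁻¹) +
        ((2 * (2 * R + 1) + 1) ^ d : ℕ) * (B * (Kg * 2 ^ (d - 1) / R ^ d))
      ≤ B * (Kh * 3 ^ d * (3 ^ d * ((1 + 2 * d * 3 ^ (d - 1)) * (2 + Real.log (2 * R + 1 : ℕ))))) + B * (Kg * 2 ^ (d - 1) * 5 ^ d) :=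
        add_le_add hA hcard
    _ = B * (Kh * 3 ^ d * (3 ^ d * ((1 + 2 * d * 3 ^ (d - 1)) * (2 + Real.log (2 * R + 1 : ℕ)))) + Kg * 2 ^ (d - 1) * 5 ^ d) := by ring


/-! ## §2 The cut-off term: the kernel `kernel₁` of the harmonic case and the `O(M₀/R)` bound of its `x`-difference -/

/-- **The cut-off term is the harmonic-case kernel**: for ANY `u` and `r ≥ 1`,
`Σ_{y ∈ sbox(2r+1)} g(p − y)·Σᵢ(dminus r i y·u(y−eᵢ) − dplus r i y·u(y+eᵢ)) = Σ_{z ∈ sbox(2r+1)} u(z)·kernel₁ r p z` (the re-indexing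
block of the tree's `harmonic_eq_sum_kernel`, which uses no harmonicity). [folklore] -/
theorem sum_gHalf_mul_cutoffTerm_eq {r : ℕ} (u : Site d → ℝ) (p : Site d) :
    ∑ y ∈ sbox (d := d) (2 * r + 1), gHalf (p - y) * ∑ i, (dminus r i y * u (y - e i) - dplus r i y * u (y + e i)) =
      ∑ z ∈ sbox (d := d) (2 * r + 1), u z * kernel₁ r p z := by
  have hL : ∑ y ∈ sbox (d := d) (2 * r + 1), gHalf (p - y) * ∑ i, (dminus r i y * u (y - e i) - dplus r i y * u (y + e i)) =
      ∑ i : Fin d, ∑ y ∈ sbox (d := d) (2 * r + 1), gHalf (p - y) * (dminus r i y * u (y - e i) - dplus r i y * u (y + e i)) := by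
    simp_rw [Finset.mul_sum]; rw [Finset.sum_comm]
  have hR : ∑ z ∈ sbox (d := d) (2 * r + 1), u z * kernel₁ r p z =
      ∑ i : Fin d, ∑ z ∈ sbox (d := d) (2 * r + 1), u z * (gHalf (p - z - e i) * dplus r i z - gHalf (p - z + e i) * dminus r i z) := by
    simp_rw [kernel₁, Finset.mul_sum]; rw [Finset.sum_comm]
  rw [hL, hR]
  refine Finset.sum_congr rfl fun i _ => ?_
  have hA : ∑ y ∈ sbox (d := d) (2 * r + 1), gHalf (p - y) * (dminus r i y * u (y - e i)) =
      ∑ z ∈ sbox (d := d) (2 * r + 1), gHalf (p - z - e i) * dplus r i z * u z := by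
    have hF : ∀ z ∉ sbox (d := d) (2 * r), gHalf (p - z - e i) * dplus r i z * u z = 0 := fun z hz => by
      rw [dplus_eq_zero_of_not_mem hz, mul_zero, zero_mul]
    rw [← sum_sbox_shift (R := 2 * r) _ hF (-e i) (fun k => by
      rw [Pi.neg_apply, abs_neg]
      by_cases h : k = i
      · subst h; simp
      · simp [h])]
    refine Finset.sum_congr rfl fun y _ => ?_
    rw [← sub_eq_add_neg, dplus_sub_e, show p - (y - e i) - e i = p - y by abel]
    ring
  have hB : ∑ y ∈ sbox (d := d) (2 * r + 1), gHalf (p - y) * (dplus r i y * u (y + e i)) =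
      ∑ z ∈ sbox (d := d) (2 * r + 1), gHalf (p - z + e i) * dminus r i z * u z := by
    have hF : ∀ z ∉ sbox (d := d) (2 * r), gHalf (p - z + e i) * dminus r i z * u z = 0 := fun z hz => by
      rw [dminus_eq_zero_of_not_mem hz, mul_zero, zero_mul]
    rw [← sum_sbox_shift (R := 2 * r) _ hF (e i) (fun k => by
      by_cases h : k = i
      · subst h; simp
      · simp [h])]
    refine Finset.sum_congr rfl fun y _ => ?_
    rw [dminus_add_e, show p - (y + e i) + e i = p - y by abel]
    ring
  have hsplit : ∀ y ∈ sbox (d := d) (2 * r + 1),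
      gHalf (p - y) * (dminus r i y * u (y - e i) - dplus r i y * u (y + e i)) =
      gHalf (p - y) * (dminus r i y * u (y - e i)) - gHalf (p - y) * (dplus r i y * u (y + e i)) := fun y _ => by ring
  rw [Finset.sum_congr rfl hsplit, Finset.sum_sub_distrib, hA, hB, ← Finset.sum_sub_distrib]
  refine Finset.sum_congr rfl fun z _ => ?_
  ring

/-- **THE `x`-DIFFERENCE OF THE CUT-OFF KERNEL IS `O(1/R)` IN `ℓ¹` AGAINST BOUNDED `u`**: for `R ≥ 4`, all `|x_k| ≤ 1` and `|u| ≤ M₀` on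
`sbox (2R+1)`, `|Σ_z u(z)(kernel₁ R (x+e_j) z − kernel₁ R x z)| ≤ M₀·d·(4·K_g·2^d·7^{d−1} + 2·K_h·28^d)/R` — `∇g·dtwo` lives on the
`4(4R+3)^{d−1}` kink sites (tree `sum_abs_dtwo_le`), `∇∇g·dminus` on the annulus; both at distance `≥ R/4`. [folklore] -/
theorem kernel_diff_sum_le (hd : 3 ≤ d) {Kg Kh : ℝ} (hKg : 0 ≤ Kg) (hKh : 0 ≤ Kh)
    (hg : ∀ (w : Site d) (i : Fin d), |gHalf (w + e i) - gHalf w| ≤ Kg / (max 1 ‖w‖) ^ (d - 1) ∧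
      |gHalf (w - e i) - gHalf w| ≤ Kg / (max 1 ‖w‖) ^ (d - 1))
    (hh : ∀ (w : Site d) (i j : Fin d), |gHalf (w + e j + e i) - gHalf (w + e j) - gHalf (w + e i) + gHalf w| ≤ Kh / (max 1 ‖w‖) ^ d)
    {R : ℕ} (hR : 4 ≤ R) (x : Site d) (hx : ‖x‖ ≤ 1) (j : Fin d) (u : Site d → ℝ) {M₀ : ℝ}
    (hM₀ : ∀ z ∈ sbox (d := d) (2 * R + 1), |u z| ≤ M₀) :
    |∑ z ∈ sbox (d := d) (2 * R + 1), u z * (kernel₁ R (x + e j) z - kernel₁ R x z)| ≤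
      M₀ * (d * (4 * Kg * 2 ^ d * 7 ^ (d - 1) + 2 * Kh * 28 ^ d)) / R := by
  have hR0 : 0 < R := by omega
  have hRr : (0 : ℝ) < R := by exact_mod_cast hR0
  have hR4 : (4 : ℝ) ≤ R := by exact_mod_cast hR
  have hd1 : 1 ≤ d := by omega
  have hM0 : 0 ≤ M₀ := (abs_nonneg _).trans (hM₀ 0 (mem_sbox.2 fun k => by simp only [Pi.zero_apply, abs_zero]; positivity))
  set D : Site d → ℝ := fun w => gHalf (w + e j) - gHalf w with hD
  -- the kernel difference, term by term
  have hdiff : ∀ z, kernel₁ R (x + e j) z - kernel₁ R x z =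
      ∑ i, (D (x - z - e i) * dtwo R i z + (D (x - z - e i) - D (x - z + e i)) * dminus R i z) := by
    intro z
    unfold kernel₁
    rw [← Finset.sum_sub_distrib]
    refine Finset.sum_congr rfl fun i _ => ?_
    simp only [hD, dtwo_eq, show x + e j - z - e i = x - z - e i + e j by abel, show x + e j - z + e i = x - z + e i + e j by abel]
    ring
  -- (α) the kink piece and (β) the annulus piece, pointwise
  have hα : ∀ z i, |D (x - z - e i) * dtwo R i z| ≤ Kg * (2 / R) ^ (d - 1) * |dtwo R i z| := by
    intro z i
    by_cases hz : |z i| ≠ (R : ℤ) ∧ |z i| ≠ 2 * (R : ℤ)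
    · rw [dtwo_eq_zero hR0 hz.1 hz.2, mul_zero, abs_zero, mul_zero]
    · -- kink site: `R ≤ |z_i|`, distance `≥ R − 2 ≥ R/2`
      have hzi : (R : ℝ) ≤ |((z i : ℤ) : ℝ)| := by
        have : (R : ℤ) ≤ |z i| := by
          rw [not_and_or, not_ne_iff, not_ne_iff] at hz
          rcases hz with h | h <;> omega
        exact_mod_cast this
      have hxe : ‖x - e i‖ ≤ 2 := by have := norm_sub_le x (e i); rw [norm_e] at this; linarith
      have hfar : (R : ℝ) / 2 ≤ max 1 ‖x - e i - z‖ := by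
        have := sub_le_max_norm_sub hxe hzi; linarith
      rw [abs_mul, show x - z - e i = x - e i - z by abel]
      exact mul_le_mul_of_nonneg_right (((hg (x - e i - z) j).1).trans (div_max_pow_le hKg hRr two_pos (d - 1) hfar))
        (abs_nonneg _)
  have hβ : ∀ z i, |(D (x - z - e i) - D (x - z + e i)) * dminus R i z| ≤ 2 * Kh * (4 / R) ^ d * (1 / R) := by
    intro z i
    by_cases hz : |z i| + 1 ≤ (R : ℤ)
    · rw [dminus_eq_zero hR0 hz, mul_zero, abs_zero]; positivity
    · have hzi : (R : ℝ) ≤ |((z i : ℤ) : ℝ)| := by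
        have : (R : ℤ) ≤ |z i| := by omega
        exact_mod_cast this
      -- two Hessians, at `w − e_i` and at `w`, `w = x − z`
      have e1 : D (x - z - e i) - D (x - z + e i) =
          -(gHalf (x - z - e i + e i + e j) - gHalf (x - z - e i + e i) - gHalf (x - z - e i + e j) + gHalf (x - z - e i)) -
          (gHalf (x - z + e i + e j) - gHalf (x - z + e i) - gHalf (x - z + e j) + gHalf (x - z)) := by
        simp only [hD, show x - z - e i + e i = x - z by abel]; ring
      have hxe : ‖x - e i‖ ≤ 2 := by have := norm_sub_le x (e i); rw [norm_e] at this; linarith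
      have hfar1 : (R : ℝ) / 4 ≤ max 1 ‖x - z - e i‖ := by
        rw [show x - z - e i = x - e i - z by abel]
        have := sub_le_max_norm_sub hxe hzi; linarith
      have hfar2 : (R : ℝ) / 4 ≤ max 1 ‖x - z‖ := by have := sub_le_max_norm_sub hx hzi; linarith
      have h1 := (hh (x - z - e i) j i).trans (div_max_pow_le hKh hRr (by norm_num : (0:ℝ) < 4) d hfar1)
      have h2 := (hh (x - z) j i).trans (div_max_pow_le hKh hRr (by norm_num : (0:ℝ) < 4) d hfar2)
      rw [abs_mul, e1]
      have h3 : |-(gHalf (x - z - e i + e i + e j) - gHalf (x - z - e i + e i) - gHalf (x - z - e i + e j) + gHalf (x - z - e i)) -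
          (gHalf (x - z + e i + e j) - gHalf (x - z + e i) - gHalf (x - z + e j) + gHalf (x - z))| ≤ 2 * Kh * (4 / R) ^ d := by
        refine (abs_sub _ _).trans ?_
        rw [abs_neg]; linarith
      exact mul_le_mul h3 (abs_dminus_le hR0 i z) (abs_nonneg _) (by positivity)
  -- summing
  have hterm : ∀ z ∈ sbox (d := d) (2 * R + 1), |u z * (kernel₁ R (x + e j) z - kernel₁ R x z)| ≤
      M₀ * ∑ i, (Kg * (2 / R) ^ (d - 1) * |dtwo R i z| + 2 * Kh * (4 / R) ^ d * (1 / R)) := by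
    intro z hz
    rw [abs_mul, hdiff z]
    refine mul_le_mul (hM₀ z hz) ((Finset.abs_sum_le_sum_abs _ _).trans (Finset.sum_le_sum fun i _ => ?_)) (abs_nonneg _) hM0
    exact (abs_add_le _ _).trans (add_le_add (hα z i) (hβ z i))
  refine (Finset.abs_sum_le_sum_abs _ _).trans ((Finset.sum_le_sum hterm).trans ?_)
  rw [← Finset.mul_sum, Finset.sum_comm]
  have hinner : ∀ i : Fin d, ∑ z ∈ sbox (d := d) (2 * R + 1), (Kg * (2 / R) ^ (d - 1) * |dtwo R i z| + 2 * Kh * (4 / R) ^ d * (1 / R)) =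
      Kg * (2 / R) ^ (d - 1) * ∑ z ∈ sbox (d := d) (2 * R + 1), |dtwo R i z| +
        ((2 * (2 * R + 1) + 1) ^ d : ℕ) * (2 * Kh * (4 / R) ^ d * (1 / R)) := fun i => by
    rw [Finset.sum_add_distrib, ← Finset.mul_sum, Finset.sum_const, card_sbox, nsmul_eq_mul]
  rw [Finset.sum_congr rfl fun i _ => hinner i]
  -- Σ_i [Kg (2/R)^{d-1} Σ_z |dtwo| + card · (…)]
  have hkink : ∀ i : Fin d, Kg * (2 / R) ^ (d - 1) * ∑ z ∈ sbox (d := d) (2 * R + 1), |dtwo R i z| ≤ 4 * Kg * 2 ^ d * 7 ^ (d - 1) / R := by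
    intro i
    have hs := sum_abs_dtwo_le (d := d) hR0 (2 * R + 1) i
    have hcnt : ((4 * (2 * (2 * R + 1) + 1) ^ (d - 1) : ℕ) : ℝ) ≤ 4 * (7 * R) ^ (d - 1) := by
      push_cast
      refine mul_le_mul_of_nonneg_left (pow_le_pow_left₀ (by positivity) (by linarith) _) (by norm_num)
    have hRd : (R : ℝ) ^ d = (R : ℝ) ^ (d - 1) * R := by rw [← pow_succ, Nat.sub_add_cancel hd1]
    calc Kg * (2 / R) ^ (d - 1) * ∑ z ∈ sbox (d := d) (2 * R + 1), |dtwo R i z|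
        ≤ Kg * (2 / R) ^ (d - 1) * (2 / R * (4 * (7 * R) ^ (d - 1))) := by
          refine mul_le_mul_of_nonneg_left (hs.trans ?_) (by positivity)
          exact mul_le_mul_of_nonneg_left hcnt (by positivity)
      _ = 4 * Kg * 2 ^ d * 7 ^ (d - 1) / R := by
          rw [div_pow, mul_pow, show (2 : ℝ) ^ d = 2 ^ (d - 1) * 2 by rw [← pow_succ, Nat.sub_add_cancel hd1]]
          field_simp
  have hann : ((2 * (2 * R + 1) + 1) ^ d : ℕ) * (2 * Kh * (4 / R) ^ d * (1 / R)) ≤ 2 * Kh * 28 ^ d / R := by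
    have hpow : (((2 * (2 * R + 1) + 1) ^ d : ℕ) : ℝ) ≤ (7 * R) ^ d := by
      push_cast
      exact pow_le_pow_left₀ (by positivity) (by linarith) d
    calc (((2 * (2 * R + 1) + 1) ^ d : ℕ) : ℝ) * (2 * Kh * (4 / R) ^ d * (1 / R))
        ≤ (7 * R) ^ d * (2 * Kh * (4 / R) ^ d * (1 / R)) := mul_le_mul_of_nonneg_right hpow (by positivity)
      _ = 2 * Kh * 28 ^ d / R := by
          rw [mul_pow, div_pow, show (28 : ℝ) ^ d = 7 ^ d * 4 ^ d by rw [← mul_pow]; norm_num]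
          field_simp
  calc M₀ * ∑ i : Fin d, (Kg * (2 / R) ^ (d - 1) * ∑ z ∈ sbox (d := d) (2 * R + 1), |dtwo R i z| +
          ((2 * (2 * R + 1) + 1) ^ d : ℕ) * (2 * Kh * (4 / R) ^ d * (1 / R)))
      ≤ M₀ * ∑ _i : Fin d, (4 * Kg * 2 ^ d * 7 ^ (d - 1) / R + 2 * Kh * 28 ^ d / R) :=
        mul_le_mul_of_nonneg_left (Finset.sum_le_sum fun i _ => add_le_add (hkink i) hann) hM0
    _ = M₀ * (d * (4 * Kg * 2 ^ d * 7 ^ (d - 1) + 2 * Kh * 28 ^ d)) / R := by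
        rw [Finset.sum_const, Finset.card_univ, Fintype.card_fin, nsmul_eq_mul]
        field_simp


end Summit.QuantumFields.YangMills.Theorems.CurvGradFlat

end
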